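import Mathlib
import HarnessLib
import Summits.ResolutionOfSingularities.ResolutionOfSingularities.Theorems.WildQuotientsWildQuotientResolutionS1aCoarseChart
import Summits.ResolutionOfSingularities.ResolutionOfSingularities.Theorems.WildQuotientsWildQuotientResolutionS1aProducerStep
import Summits.ResolutionOfSingularities.ResolutionOfSingularities.Theorems.WildQuotientsWildQuotientResolutionS1aCentreNeBot
import Summits.ResolutionOfSingularities.ResolutionOfSingularities.Theorems.WildQuotientsWildQuotientResolutionS1aReesBigrading

/-!
# S1a — (G1c) COVER NORMALISATION: σ-invariant cover elements of bidegree `(d̄, 0)` with `b ∈ K d̄`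

[OURS · L1 W4.5c · lead-1 g6] — NOT a statement of the manuscript; counted 0; AI-level work, weaker than expert
review. Crux stmt-ResolutionOfSingularities-17941 (`WildQuotients.CyclicQuotientFourfolds`), line `s1a-logminvertex`,
stub `stub_localGame` (producer); H3-SCHEME §2 (G1c) «NORMALISING THE COVER FAMILY»; A5b design memo
`Cruxes/CyclicQuotientFourfolds/Lines/s1a-logminvertex-A5B-DESIGN.md` (N1).

H3ʼs `CoverClause B 𝒜 σ f w` (PROVED by 033, `coverClause_of_sigma_norms`, p576517) gives finitely many σ-invariant
bihomogeneous `h_j = b_j T^{d_j} ∈ R^w` of bidegree `(d_j, δ_j)`, `0 < d_j`, with every `fᵢ T^{wᵢ}` nilpotent modulo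
`(h_j)_j`. The chart algebra of `…S1aChartRing*` is written for cover elements of bidegree `(d̄, 0)` with `b ∈ K d̄`
(`CoarseChart.coverElement`). This file normalises: with (T1) of the node (homogeneous units whose degrees generate a
subgroup of finite index `N₀`) pick a homogeneous unit `u_j` of degree `−N₀ • δ_j`
(`CentreNeBot.exists_isUnit_mem_of_mem_closure`, `AddSubgroup.nsmul_index_mem`), take its σ-NORM
`v_j = ∏_{k<p} σᵏ u_j` (σ-invariant as `σ^[p] = id`, homogeneous of degree `−p N₀ • δ_j`, a unit), replace `h_j` by
`h̃_j = h_j^{p N₀} · v_j` (bidegree `(p N₀ d_j, 0)`), and raise all `h̃_j` to the common `T`-degree `d̄ = d₀ ∏ n_j`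
(a multiple of any prescribed `d₀ > 0`, e.g. a Veronese degree). Same basic opens, so the cover survives in radical form.

* `sigmaNorm σ p u = ∏_{k : Fin p} σ^[k] u`, `sigma_sigmaNorm` (σ-invariant), `sigmaNorm_mem` (degree `p • e`),
  `isUnit_sigmaNorm`;
* **`exists_normalised_cover`** — the normalised cover: `∃ d̄ (0 < d̄, d₀ ∣ d̄) L (y : Fin L → 𝒜 0) (hy : y j ∈ K d̄),
  (∀ j, σ (y j) = y j) ∧ ∀ i, fᵢ T^{wᵢ} ∈ √(span {coverElement d̄ (y j)})`.
-/

set_option linter.dupNamespace false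

noncomputable section

open Literature.AlgebraicGeometry.Resolution
open scoped LaurentPolynomial
open Summit.ResolutionOfSingularities.ResolutionOfSingularities.Theorems.WildQuotientResolution.S1.ProducerStep
open Summit.ResolutionOfSingularities.ResolutionOfSingularities.Theorems.WildQuotientResolution.S1.CentreNeBot
open Summit.ResolutionOfSingularities.ResolutionOfSingularities.Theorems.WildQuotientResolution.S1.ReesBigrading

namespace Summit.ResolutionOfSingularities.ResolutionOfSingularities.Theorems.WildQuotientResolution.S1.CoarseChart

universe u v

/-! ## The σ-norm of a unit -/

section Norm

variable {ι : Type v} [AddCommGroup ι] [DecidableEq ι] {B : Type u} [CommRing B]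
  (𝒜 : ι → AddSubgroup B) [GradedRing 𝒜] (σ : B ≃+* B) (p : ℕ)

omit [AddCommGroup ι] [DecidableEq ι] [GradedRing 𝒜] in
/-- Iterates of a graded automorphism are graded. -/
theorem sigma_iterate_mem (hσ𝒜 : ∀ (i : ι) (x : B), x ∈ 𝒜 i → σ x ∈ 𝒜 i) (k : ℕ) {e : ι} {x : B} (hx : x ∈ 𝒜 e) :
    (⇑σ)^[k] x ∈ 𝒜 e := by
  induction k with
  | zero => exact hx
  | succ k ih => rw [Function.iterate_succ_apply']; exact hσ𝒜 e _ ih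

/-- Iterates preserve units. -/
theorem isUnit_sigma_iterate (k : ℕ) {x : B} (hx : IsUnit x) : IsUnit ((⇑σ)^[k] x) := by
  induction k with
  | zero => exact hx
  | succ k ih => rw [Function.iterate_succ_apply']; exact ih.map σ

/-- **The σ-norm** `N_σ(u) = ∏_{k<p} σᵏ u`. [OURS · L1 W4.5c] -/
def sigmaNorm (u : B) : B := ∏ k : Fin p, (⇑σ)^[k] u

/-- The σ-norm is σ-invariant when `σ^[p] = id`. -/
theorem sigma_sigmaNorm (hσp : ∀ x : B, (⇑σ)^[p] x = x) (u : B) : σ (sigmaNorm σ p u) = sigmaNorm σ p u := by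
  unfold sigmaNorm
  rcases Nat.eq_zero_or_pos p with hp0 | hpos
  · subst hp0; simp
  · obtain ⟨p', rfl⟩ : ∃ p', p = p' + 1 := ⟨p - 1, by omega⟩
    rw [map_prod]
    have h1 : ∀ k : Fin (p' + 1), σ ((⇑σ)^[k] u) = (⇑σ)^[(k : ℕ) + 1] u := fun k => by
      rw [Function.iterate_succ_apply']
    simp_rw [h1]
    rw [Fin.prod_univ_castSucc, Fin.prod_univ_succ]
    simp only [Fin.val_castSucc, Fin.val_last, Fin.val_zero, Fin.val_succ, Function.iterate_zero, id_eq]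
    rw [hσp u, mul_comm]

/-- The σ-norm of a homogeneous element of degree `e` is homogeneous of degree `p • e` (σ graded). -/
theorem sigmaNorm_mem (hσ𝒜 : ∀ (i : ι) (x : B), x ∈ 𝒜 i → σ x ∈ 𝒜 i) {e : ι} {u : B} (hu : u ∈ 𝒜 e) :
    sigmaNorm σ p u ∈ 𝒜 (p • e) := by
  unfold sigmaNorm
  have := SetLike.prod_mem_graded 𝒜 (fun _ : Fin p => e) (fun k : Fin p => (⇑σ)^[k] u)
    (F := Finset.univ) (fun k _ => sigma_iterate_mem 𝒜 σ hσ𝒜 k hu)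
  simpa using this

/-- The σ-norm of a unit is a unit. -/
theorem isUnit_sigmaNorm {u : B} (hu : IsUnit u) : IsUnit (sigmaNorm σ p u) := by
  unfold sigmaNorm
  exact Finset.prod_induction _ IsUnit (fun _ _ => IsUnit.mul) isUnit_one
    (fun k _ => isUnit_sigma_iterate σ k hu)

end Norm

/-! ## Normalising the cover -/

section Normalise

variable {ι : Type v} [AddCommGroup ι] [DecidableEq ι] {B : Type u} [CommRing B]
  (𝒜 : ι → AddSubgroup B) [GradedRing 𝒜] {c : ℕ} (f : Fin c → B) (w : Fin c → ℕ) (σ : B ≃+* B) {p : ℕ}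

/-- Powers of a monomial of `B[T;T⁻¹]`. -/
theorem C_mul_T_pow (x : B) (n : ℤ) (m : ℕ) :
    (LaurentPolynomial.C x * LaurentPolynomial.T n) ^ m = LaurentPolynomial.C (x ^ m) * LaurentPolynomial.T (m * n) := by
  rw [mul_pow, ← map_pow, LaurentPolynomial.T_pow]

/-- **(G1c) COVER NORMALISATION.** From a tame node's units (T1), a graded `σ` with `σ^[p] = id`, `0 < p`, and H3's
`CoverClause`: a σ-INVARIANT cover family of bidegree `(d̄, 0)`, `b ∈ K d̄`, with `d̄` a positive multiple of any
prescribed `d₀ > 0`, and every `fᵢ T^{wᵢ}` in the radical of the ideal it spans. [OURS · L1 W4.5c] -/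
theorem exists_normalised_cover (hp : 0 < p) (hσ𝒜 : ∀ (i : ι) (x : B), x ∈ 𝒜 i → σ x ∈ 𝒜 i)
    (hσp : ∀ x : B, (⇑σ)^[p] x = x)
    (hT1 : ∃ s : Finset ι, (∀ e ∈ s, ∃ u : B, IsUnit u ∧ u ∈ 𝒜 e) ∧ (AddSubgroup.closure (s : Set ι)).FiniteIndex)
    (hcov : CoverClause B 𝒜 σ f w) (d₀ : ℕ) (hd₀ : 0 < d₀) :
    ∃ (dbar : ℕ) (_ : 0 < dbar) (_ : d₀ ∣ dbar) (L : ℕ) (y : Fin L → ↥(𝒜 0))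
      (hy : ∀ j, y j ∈ (traceFiltration 𝒜 f w).ideal dbar),
      (∀ j, σ (y j : B) = y j) ∧
      ∀ i : Fin c, cobordantAlgebra.u' f w i ∈
        (Ideal.span (Set.range fun j => coverElement 𝒜 f w dbar (y j) (hy j))).radical := by
  classical
  obtain ⟨L, dl, δl, bl, hmem, hprop, hnil⟩ := hcov
  obtain ⟨s, hs, hfin⟩ := hT1
  haveI := hfin
  -- the index and the units
  set N₀ := (AddSubgroup.closure (s : Set ι)).index with hN₀
  have hN₀pos : 0 < N₀ := Nat.pos_of_ne_zero (AddSubgroup.finiteIndex_iff.mp hfin)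
  have hunit : ∀ j : Fin L, ∃ u : B, IsUnit u ∧ u ∈ 𝒜 (-(N₀ • δl j)) := fun j =>
    exists_isUnit_mem_of_mem_closure 𝒜 hs (by
      rw [← neg_nsmul]
      exact AddSubgroup.nsmul_index_mem (AddSubgroup.closure (s : Set ι)) _)
  choose u hu huA using hunit
  -- the normalised coefficients `y' j = b_j^{p N₀} · N_σ(u_j)` and their `T`-degrees `n j = p N₀ d_j`
  let v : Fin L → B := fun j => sigmaNorm σ p (u j)
  let y' : Fin L → B := fun j => bl j ^ (p * N₀) * v j
  let n : Fin L → ℕ := fun j => p * N₀ * (dl j).toNat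
  have hdl : ∀ j, ((dl j).toNat : ℤ) = dl j := fun j => Int.toNat_of_nonneg (le_of_lt (hprop j).1)
  have hn : ∀ j, ((p * N₀ : ℕ) : ℤ) * dl j = ((n j : ℕ) : ℤ) := fun j => by
    simp only [n]; push_cast; rw [hdl j]
  have hnpos : ∀ j, 0 < n j := fun j =>
    Nat.mul_pos (Nat.mul_pos hp hN₀pos) (by have := (hprop j).1; omega)
  have hy'0 : ∀ j, y' j ∈ 𝒜 0 := by
    intro j
    have h1 : bl j ^ (p * N₀) ∈ 𝒜 ((p * N₀) • δl j) := SetLike.pow_mem_graded _ (hprop j).2.1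
    have h2 : v j ∈ 𝒜 (p • (-(N₀ • δl j))) := sigmaNorm_mem 𝒜 σ p hσ𝒜 (huA j)
    have := SetLike.mul_mem_graded h1 h2
    convert this using 2
    rw [smul_neg, ← mul_nsmul', add_neg_cancel]
  have hσy' : ∀ j, σ (y' j) = y' j := by
    intro j
    show σ (bl j ^ (p * N₀) * v j) = bl j ^ (p * N₀) * v j
    rw [map_mul, map_pow, (hprop j).2.2, sigma_sigmaNorm σ p hσp]
  -- `h̃_j = h_j^{pN₀} · C(v_j)` as elements of `R^w`
  have hvmem : ∀ j, LaurentPolynomial.C (v j) ∈ cobordantAlgebra f w := fun j => by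
    rw [LaurentPolynomial.C_eq_algebraMap]; exact Subalgebra.algebraMap_mem _ _
  have htilde : ∀ j, (⟨_, hmem j⟩ : ↥(cobordantAlgebra f w)) ^ (p * N₀) * ⟨_, hvmem j⟩ =
      ⟨LaurentPolynomial.C (y' j) * LaurentPolynomial.T (n j : ℤ), by
        have := mul_mem (pow_mem (hmem j) (p * N₀)) (hvmem j)
        rwa [C_mul_T_pow, mul_right_comm, ← map_mul, hn j] at this⟩ := by
    intro j
    refine Subtype.ext ?_
    simp only [MulMemClass.coe_mul, SubmonoidClass.coe_pow]
    rw [C_mul_T_pow, mul_right_comm, ← map_mul, hn j]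
  have hy'mem : ∀ j, LaurentPolynomial.C (y' j) * LaurentPolynomial.T (n j : ℤ) ∈ cobordantAlgebra f w := fun j => by
    have h := SetLike.coe_mem ((⟨_, hmem j⟩ : ↥(cobordantAlgebra f w)) ^ (p * N₀) * ⟨_, hvmem j⟩)
    rwa [htilde j] at h
  -- common degree
  let dbar : ℕ := d₀ * ∏ j, n j
  have hdvd : ∀ j, n j ∣ dbar := fun j => Dvd.dvd.mul_left (Finset.dvd_prod_of_mem n (Finset.mem_univ j)) d₀
  have hdbar : 0 < dbar := Nat.mul_pos hd₀ (Finset.prod_pos fun j _ => hnpos j)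
  let m : Fin L → ℕ := fun j => dbar / n j
  have hmn : ∀ j, m j * n j = dbar := fun j => Nat.div_mul_cancel (hdvd j)
  -- the final coefficients `y j = (y' j)^{m j}`
  let y : Fin L → ↥(𝒜 0) := fun j => (⟨y' j, hy'0 j⟩ : ↥(𝒜 0)) ^ m j
  have hycoe : ∀ j, ((y j : ↥(𝒜 0)) : B) = y' j ^ m j := fun j => rfl
  have hpow : ∀ j, LaurentPolynomial.C ((y j : ↥(𝒜 0)) : B) * LaurentPolynomial.T (dbar : ℤ) =
      (LaurentPolynomial.C (y' j) * LaurentPolynomial.T (n j : ℤ)) ^ m j := fun j => by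
    rw [C_mul_T_pow, hycoe, ← hmn j]
    push_cast
    ring_nf
  have hymem : ∀ j, LaurentPolynomial.C ((y j : ↥(𝒜 0)) : B) * LaurentPolynomial.T (dbar : ℤ) ∈
      cobordantAlgebra f w := fun j => by
    rw [hpow j]
    exact pow_mem (hy'mem j) (m j)
  have hy : ∀ j, y j ∈ (traceFiltration 𝒜 f w).ideal dbar := fun j =>
    (mem_traceFiltration_iff 𝒜 f w).mpr (((C_mul_T_mem_iff f w).mp (hymem j)) dbar rfl)
  refine ⟨dbar, hdbar, Dvd.intro _ rfl, L, y, hy, fun j => ?_, fun i => ?_⟩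
  · rw [hycoe, map_pow, hσy']
  · -- the radical statement
    obtain ⟨N, hN⟩ := hnil i
    set I₁ := Ideal.span (Set.range fun j => coverElement 𝒜 f w dbar (y j) (hy j)) with hI₁
    have hle : Ideal.span (Set.range fun j => (⟨_, hmem j⟩ : ↥(cobordantAlgebra f w))) ≤ I₁.radical := by
      rw [Ideal.span_le]
      rintro _ ⟨j, rfl⟩
      -- `h_j^{p N₀ m_j} · v_j^{m_j} = coverElement dbar (y j)`
      have hcov : ((⟨_, hmem j⟩ : ↥(cobordantAlgebra f w)) ^ (p * N₀) * ⟨_, hvmem j⟩) ^ m j =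
          coverElement 𝒜 f w dbar (y j) (hy j) := by
        rw [htilde j]
        exact Subtype.ext (by rw [SubmonoidClass.coe_pow, coe_coverElement, hpow j])
      have hvunit : IsUnit (⟨_, hvmem j⟩ : ↥(cobordantAlgebra f w)) := by
        have : (⟨_, hvmem j⟩ : ↥(cobordantAlgebra f w)) = algebraMap B _ (v j) :=
          Subtype.ext (by rw [cobordantAlgebra.coe_algebraMap])
        rw [this]
        exact (isUnit_sigmaNorm σ p (hu j)).map _
      refine ⟨(p * N₀) * m j, ?_⟩
      obtain ⟨vinv, hvinv⟩ := hvunit.exists_right_inv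
      have : (⟨_, hmem j⟩ : ↥(cobordantAlgebra f w)) ^ ((p * N₀) * m j) =
          coverElement 𝒜 f w dbar (y j) (hy j) * vinv ^ m j := by
        rw [← hcov, pow_mul, mul_pow, mul_assoc, ← mul_pow, hvinv, one_pow, mul_one]
      rw [this]
      exact Ideal.mul_mem_right _ _ (Ideal.subset_span ⟨j, rfl⟩)
    exact Ideal.mem_radical_of_pow_mem (hle hN)

end Normalise

end Summit.ResolutionOfSingularities.ResolutionOfSingularities.Theorems.WildQuotientResolution.S1.CoarseChart

end
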